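import Mathlib
import Literature.MathematicalPhysics.QuantumFieldTheory.Luscher2010.TrivializingMaps
import Literature.MathematicalPhysics.QuantumFieldTheory.Luscher2010.FlowActionSeries
import Summits.Ventures.LatticeQCDFlow.TrivializingMaps.TruncationDefect
import Summits.Ventures.LatticeQCDFlow.TrivializingMaps.HaarByPartsZeroModes
import Summits.Ventures.LatticeQCDFlow.TrivializingMaps.ZeroModes
import HarnessLib

/-!
# The Poisson problem `Δφ = g + const` on `SU(n)^E` in a finite-dimensional `Δ`-stable space

HONEST FRAMING: exact (Metropolis-corrected) sampling algorithms for lattice gauge theory; figures of merit are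
autocorrelation/cost numbers at stated couplings and volumes; no continuum-physics claim.

Lüscher, CMP 293 (2010) 899, §4.3: the orders `S̃^{(k)}` of the flow action are obtained by solving
`Δ S̃^{(0)} = S + Ċ^{(0)}` and `Δ S̃^{(k)} = -∑ ∂S̃^{(j)}·∂S̃^{(k-1-j)} + Ċ^{(k)}` (eqs. (4.12)–(4.15)), i.e. by
inverting the link Laplacian on the orthogonal complement of the constants; §4.4: for the Wilson action
"`Δ` maps any polynomial in `W₀, W₁, …` [Wilson loops] into another polynomial in these variables", so each
order is found by linear algebra in a FINITE-DIMENSIONAL `Δ`-invariant space of loop polynomials.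

This file proves the abstract solvability statement behind that procedure, for the Laplacian `linkLap`
typed in `Luscher2010/TrivializingMaps.lean` and the product Haar measure `D[U]`:

**Theorem (`exists_linkLap_eq_sub_mean`).** Let `P` be a finite-dimensional space of smooth ambient
functionals `M_n(ℂ)^E → ℝ` containing the constants and stable under `Δ`. Then for every `g ∈ P` there is
`f ∈ P` with `Δf = g - ∫ D[U] g` on `SU(n)^E`.

Proof (rank–nullity, no spectral theory): on `P₀ = {f ∈ P | f(ι 1) = 0}` the maps `f ↦ (Δf)|_{SU(n)^E}`
and `f ↦ f|_{SU(n)^E}` have the SAME kernel — `Δf = 0` on the manifold forces `f` constant on the manifold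
(`ZeroModes`: Green's identity + surjectivity of `exp`), and `f = 0` on the manifold forces `Δf = 0` there
(`Δ` only sees the restriction) — hence ranges of equal dimension; the first range lies in the mean-zero
part of `V = P|_{SU(n)^E}` (`∫ Δf = 0`, Green), the second is the part of `V` vanishing at `1`; both are
kernels of functionals `V → ℝ` not vanishing on the constant `1`, so they have dimension `dim V - 1`, and the
inclusion is an equality. Support and degree control come for free: the solution lies in the same `P`
(used with `P` = loop polynomials of bounded degree supported in a fixed link set, file `LinkPolynomials`).

References: M. Lüscher, CMP 293 (2010) 899 [Luscher2010Trivializing, arXiv:0907.5491], §4.2 eqs. (4.6)–(4.11),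
§4.3 eqs. (4.12)–(4.15), §4.4 (eqs. (4.16)–(4.22)).
-/

namespace Summit.Ventures.LatticeQCDFlow.TrivializingMaps

open MeasureTheory
open Literature.MathematicalPhysics.QuantumFieldTheory
open Literature.MathematicalPhysics.QuantumFieldTheory.Luscher2010
open scoped Matrix Matrix.Norms.Frobenius ContDiff

noncomputable section

variable {d L n : ℕ} [NeZero L]

/-! ## §1. Restriction to the field manifold; Green consequences -/

/-- Restriction of ambient functionals to the field manifold `SU(n)^E` (`f ↦ f ∘ ι`), a linear map.
[cite: Luscher2010Trivializing, §2.1] -/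
def restrictSU : (AmbConfig d L n → ℝ) →ₗ[ℝ]
    (GaugeConfig d L (Matrix.specialUnitaryGroup (Fin n) ℂ) → ℝ) where
  toFun f U := f (WilsonFlow.coeConfig U)
  map_add' _ _ := rfl
  map_smul' _ _ := rfl

omit [NeZero L] in
/-- Unfolding `restrictSU`. [folklore] -/ @[simp] theorem restrictSU_apply (f : AmbConfig d L n → ℝ)
    (U : GaugeConfig d L (Matrix.specialUnitaryGroup (Fin n) ℂ)) :
    restrictSU f U = f (WilsonFlow.coeConfig U) := rfl

/-- Evaluation of a manifold functional at the unit field `U ≡ 1`. [folklore] -/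
def evalOne : (GaugeConfig d L (Matrix.specialUnitaryGroup (Fin n) ℂ) → ℝ) →ₗ[ℝ] ℝ where
  toFun w := w fun _ => 1
  map_add' _ _ := rfl
  map_smul' _ _ := rfl

omit [NeZero L] in
/-- Unfolding `evalOne`. [folklore] -/
@[simp] theorem evalOne_apply (w : GaugeConfig d L (Matrix.specialUnitaryGroup (Fin n) ℂ) → ℝ) :
    evalOne w = w fun _ => 1 := rfl

/-- `D[U]` on `SU(n)^E` is a probability measure. [cite: Luscher2010Trivializing, §2.1 eq. (2.1)] -/
instance isProbabilityMeasure_trivialMeasure_SU :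
    IsProbabilityMeasure (trivialMeasure (Matrix.specialUnitaryGroup (Fin n) ℂ) d L) := by
  haveI : SecondCountableTopology (Matrix (Fin n) (Fin n) ℂ) :=
    inferInstanceAs (SecondCountableTopology (Fin n → Fin n → ℂ))
  haveI : SecondCountableTopology (Matrix.specialUnitaryGroup (Fin n) ℂ) :=
    Topology.IsEmbedding.subtypeVal.secondCountableTopology
  unfold trivialMeasure; infer_instance

/-- **Green: `∫ D[U] Δχ = 0`** for smooth `χ` (pair `Δχ` with the constant `1` in eq. (4.8)).
[cite: Luscher2010Trivializing, §4.2 eq. (4.8)] -/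
theorem integral_linkLap_eq_zero (B : SuBasis n) {χ : AmbConfig d L n → ℝ} (hχ : ContDiff ℝ ∞ χ) :
    ∫ U, linkLap B χ (WilsonFlow.coeConfig U)
      ∂(trivialMeasure (Matrix.specialUnitaryGroup (Fin n) ℂ) d L) = 0 := by
  have h := integral_mul_linkLap B (φ := fun _ => (1 : ℝ)) contDiff_const hχ
  have h0 : ∀ (e : Edge d L) (a : B.ι) (W : AmbConfig d L n),
      linkDeriv e (B.T a) (fun _ : AmbConfig d L n => (1 : ℝ)) W = 0 := fun e a W => by
    unfold linkDeriv; exact deriv_const (0 : ℝ) (1 : ℝ)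
  simp only [one_mul, h0, zero_mul, integral_zero, Finset.sum_const_zero] at h
  exact h

/-- A nonzero linear functional on a finite-dimensional real space has a kernel of codimension one.
[folklore] -/
theorem finrank_ker_add_one_of_apply_ne_zero {V : Type*} [AddCommGroup V] [Module ℝ V]
    [FiniteDimensional ℝ V] (φ : V →ₗ[ℝ] ℝ) {v : V} (hv : φ v ≠ 0) :
    Module.finrank ℝ (LinearMap.ker φ) + 1 = Module.finrank ℝ V := by
  have hr : LinearMap.range φ = ⊤ := by
    rw [LinearMap.range_eq_top]
    intro r
    exact ⟨(r / φ v) • v, by rw [map_smul, smul_eq_mul, div_mul_cancel₀ r hv]⟩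
  have h := LinearMap.finrank_range_add_finrank_ker φ
  rw [hr, finrank_top, Module.finrank_self] at h
  omega

/-! ## §2. `Δ` on a space of smooth functionals; the subspace vanishing at `ι 1` -/

section Solver

variable (B : SuBasis n) (P : Submodule ℝ (AmbConfig d L n → ℝ))

/-- `Δ` as a linear map on a space `P` of smooth functionals (linearity of `Δ` on smooth functionals).
[cite: Luscher2010Trivializing, §4.2 eq. (4.6)] -/
def lapP (hs : ∀ f ∈ P, ContDiff ℝ ∞ f) : P →ₗ[ℝ] (AmbConfig d L n → ℝ) where
  toFun f := linkLap B (f : AmbConfig d L n → ℝ)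
  map_add' f g := by
    funext W
    show linkLap B (fun W' => (f : AmbConfig d L n → ℝ) W' + (g : AmbConfig d L n → ℝ) W') W =
      linkLap B (f : AmbConfig d L n → ℝ) W + linkLap B (g : AmbConfig d L n → ℝ) W
    exact linkLap_add_of_contDiff B (hs f f.2) (hs g g.2) W
  map_smul' c f := by
    funext W
    show linkLap B (fun W' => c * (f : AmbConfig d L n → ℝ) W') W =
      c * linkLap B (f : AmbConfig d L n → ℝ) W
    exact linkLap_const_mul' B c _ W

/-- The subspace `P₀ = {f ∈ P | f(ι 1) = 0}` (kills the constant ambiguity). [folklore] -/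
def P0 : Submodule ℝ (AmbConfig d L n → ℝ) := P ⊓ LinearMap.ker (evalOne ∘ₗ restrictSU)

omit [NeZero L] in
/-- Membership in `P0`: in `P` and vanishing at the unit configuration. [folklore] -/
theorem mem_P0 (f : AmbConfig d L n → ℝ) :
    f ∈ P0 P ↔ f ∈ P ∧ f (WilsonFlow.coeConfig fun _ => 1) = 0 := by
  simp [P0, LinearMap.mem_ker]

omit [NeZero L] in
/-- `P0 ≤ P`. [folklore] -/ theorem P0_le : P0 (d := d) (L := L) (n := n) P ≤ P := inf_le_left

/-- `P₀` is finite-dimensional when `P` is. [folklore] -/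
instance [FiniteDimensional ℝ P] : FiniteDimensional ℝ (P0 (d := d) (L := L) (n := n) P) := by
  unfold P0; infer_instance

/-- `T₀ f = (Δf)|_{SU(n)^E}` on `P₀`. -/
def T0 (hs : ∀ f ∈ P, ContDiff ℝ ∞ f) :
    P0 P →ₗ[ℝ] (GaugeConfig d L (Matrix.specialUnitaryGroup (Fin n) ℂ) → ℝ) :=
  (restrictSU ∘ₗ lapP B P hs) ∘ₗ Submodule.inclusion (P0_le P)

/-- `ρ₀ f = f|_{SU(n)^E}` on `P₀`. -/
def rho0 : P0 P →ₗ[ℝ] (GaugeConfig d L (Matrix.specialUnitaryGroup (Fin n) ℂ) → ℝ) :=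
  restrictSU ∘ₗ (P0 P).subtype

/-- `ρ f = f|_{SU(n)^E}` on `P`; its range is `V = P|_{SU(n)^E}`. -/
def rhoP : P →ₗ[ℝ] (GaugeConfig d L (Matrix.specialUnitaryGroup (Fin n) ℂ) → ℝ) :=
  restrictSU ∘ₗ P.subtype

variable {B P}

/-- Unfolding `T0`. [folklore] -/ theorem T0_apply (hs : ∀ f ∈ P, ContDiff ℝ ∞ f) (f : P0 P)
    (U : GaugeConfig d L (Matrix.specialUnitaryGroup (Fin n) ℂ)) :
    T0 B P hs f U = linkLap B (f : AmbConfig d L n → ℝ) (WilsonFlow.coeConfig U) := rfl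

omit [NeZero L] in
/-- Unfolding `rho0`. [folklore] -/
theorem rho0_apply (f : P0 P) (U : GaugeConfig d L (Matrix.specialUnitaryGroup (Fin n) ℂ)) :
    rho0 P f U = (f : AmbConfig d L n → ℝ) (WilsonFlow.coeConfig U) := rfl

omit [NeZero L] in
/-- Unfolding `rhoP`. [folklore] -/
theorem rhoP_apply (f : P) (U : GaugeConfig d L (Matrix.specialUnitaryGroup (Fin n) ℂ)) :
    rhoP P f U = (f : AmbConfig d L n → ℝ) (WilsonFlow.coeConfig U) := rfl

/-- **Same kernel**: on `P₀`, `Δf = 0` on `SU(n)^E` iff `f = 0` on `SU(n)^E` (⇒: zero modes of `Δ` are the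
constants, `ZeroModes`; ⇐: `Δ` on the manifold only sees the restriction). [cite: Luscher2010Trivializing, §4.2] -/
theorem ker_T0_eq (hs : ∀ f ∈ P, ContDiff ℝ ∞ f) :
    LinearMap.ker (T0 B P hs) = LinearMap.ker (rho0 P) := by
  ext f
  simp only [LinearMap.mem_ker]
  have hf0 : (f : AmbConfig d L n → ℝ) (WilsonFlow.coeConfig fun _ => 1) = 0 :=
    ((mem_P0 P _).1 f.2).2
  have hsm : ContDiff ℝ ∞ (f : AmbConfig d L n → ℝ) := hs _ ((mem_P0 P _).1 f.2).1
  constructor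
  · intro h
    funext U
    have hc := (apply_coeConfig_eq_of_linkLap_eq_const B hsm (κ := 0)
      (fun U' => by simpa [T0_apply] using congrFun h U')).2 U
    rw [rho0_apply, hc, hf0]; rfl
  · intro h
    funext U
    rw [T0_apply]
    exact linkLap_coeConfig_eq_zero_of_eq_zero B (fun U' => by simpa [rho0_apply] using congrFun h U') U

/-- Hence `dim range T₀ = dim range ρ₀` (rank–nullity on `P₀`). [folklore] -/
theorem finrank_range_T0_eq (hs : ∀ f ∈ P, ContDiff ℝ ∞ f) [FiniteDimensional ℝ P] :
    Module.finrank ℝ (LinearMap.range (T0 B P hs)) = Module.finrank ℝ (LinearMap.range (rho0 P)) := by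
  have h1 := LinearMap.finrank_range_add_finrank_ker (T0 B P hs)
  have h2 := LinearMap.finrank_range_add_finrank_ker (rho0 (d := d) (L := L) (n := n) P)
  rw [ker_T0_eq hs] at h1
  omega

/-- Members of `V = P|_{SU(n)^E}` are continuous (restrictions of smooth functionals). -/
theorem continuous_of_mem_range_rhoP (hs : ∀ f ∈ P, ContDiff ℝ ∞ f)
    {w : GaugeConfig d L (Matrix.specialUnitaryGroup (Fin n) ℂ) → ℝ} (hw : w ∈ LinearMap.range (rhoP P)) :
    Continuous w := by
  obtain ⟨f, rfl⟩ := hw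
  exact (hs _ f.2).continuous.comp WilsonFlow.continuous_coeConfig

/-- The Haar mean `v ↦ ∫ D[U] v` as a linear functional on `V = P|_{SU(n)^E}`.
[cite: Luscher2010Trivializing, §2.1 eq. (2.3)] -/
def meanV (hs : ∀ f ∈ P, ContDiff ℝ ∞ f) : LinearMap.range (rhoP P) →ₗ[ℝ] ℝ where
  toFun v := ∫ U, (v : GaugeConfig d L (Matrix.specialUnitaryGroup (Fin n) ℂ) → ℝ) U
    ∂(trivialMeasure (Matrix.specialUnitaryGroup (Fin n) ℂ) d L)
  map_add' v w := by
    show ∫ U, ((v : GaugeConfig d L (Matrix.specialUnitaryGroup (Fin n) ℂ) → ℝ) U +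
        (w : GaugeConfig d L (Matrix.specialUnitaryGroup (Fin n) ℂ) → ℝ) U) ∂_ = _
    exact integral_add (integrable_trivialMeasure_of_continuous (continuous_of_mem_range_rhoP hs v.2))
      (integrable_trivialMeasure_of_continuous (continuous_of_mem_range_rhoP hs w.2))
  map_smul' c v := by
    show ∫ U, c * (v : GaugeConfig d L (Matrix.specialUnitaryGroup (Fin n) ℂ) → ℝ) U ∂_ = c * _
    exact integral_const_mul c _

/-- Unfolding `meanV`. [folklore] -/
theorem meanV_apply (hs : ∀ f ∈ P, ContDiff ℝ ∞ f) (v : LinearMap.range (rhoP P)) :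
    meanV hs v = ∫ U, (v : GaugeConfig d L (Matrix.specialUnitaryGroup (Fin n) ℂ) → ℝ) U
      ∂(trivialMeasure (Matrix.specialUnitaryGroup (Fin n) ℂ) d L) := rfl

variable (P) in
/-- Evaluation at `1` as a functional on `V`. -/
def evalV : LinearMap.range (rhoP P) →ₗ[ℝ] ℝ :=
  evalOne ∘ₗ (LinearMap.range (rhoP P)).subtype

omit [NeZero L] in
/-- Unfolding `evalV`. [folklore] -/ theorem evalV_apply (v : LinearMap.range (rhoP P)) :
    evalV P v = (v : GaugeConfig d L (Matrix.specialUnitaryGroup (Fin n) ℂ) → ℝ) fun _ => 1 := rfl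

/-- The constant `1 ∈ V`. -/
def oneV (h1 : (fun _ => (1 : ℝ)) ∈ P) : LinearMap.range (rhoP P) :=
  ⟨rhoP P ⟨fun _ => 1, h1⟩, LinearMap.mem_range_self _ _⟩

omit [NeZero L] in
/-- The underlying function of `oneV` is the constant `1`. [folklore] -/
theorem coe_oneV (h1 : (fun _ => (1 : ℝ)) ∈ P) :
    (oneV h1 : GaugeConfig d L (Matrix.specialUnitaryGroup (Fin n) ℂ) → ℝ) = fun _ => 1 := rfl

/-- The Haar mean of the constant `1` is `1`. [folklore] -/
theorem meanV_oneV (hs : ∀ f ∈ P, ContDiff ℝ ∞ f) (h1 : (fun _ => (1 : ℝ)) ∈ P) :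
    meanV hs (oneV h1) = 1 := by
  rw [meanV_apply, coe_oneV]
  simp [integral_const, probReal_univ]

omit [NeZero L] in
/-- The constant `1` evaluates to `1` at the unit configuration. [folklore] -/
theorem evalV_oneV (h1 : (fun _ => (1 : ℝ)) ∈ P) : evalV P (oneV h1) = 1 := rfl

/-- `range T₀ ⊆` mean-zero part of `V` (`Δf ∈ P` and `∫ Δf = 0`). [cite: Luscher2010Trivializing, §4.2 eq. (4.8)] -/
theorem range_T0_le (hs : ∀ f ∈ P, ContDiff ℝ ∞ f) (hΔ : ∀ f ∈ P, linkLap B f ∈ P) :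
    LinearMap.range (T0 B P hs) ≤
      (LinearMap.ker (meanV hs)).map (LinearMap.range (rhoP P)).subtype := by
  rintro w ⟨f, rfl⟩
  have hfP : (f : AmbConfig d L n → ℝ) ∈ P := ((mem_P0 P _).1 f.2).1
  have hmem : T0 B P hs f ∈ LinearMap.range (rhoP P) :=
    ⟨⟨linkLap B (f : AmbConfig d L n → ℝ), hΔ _ hfP⟩, rfl⟩
  refine ⟨⟨T0 B P hs f, hmem⟩, ?_, rfl⟩
  show meanV hs ⟨T0 B P hs f, hmem⟩ = 0
  rw [meanV_apply]
  show ∫ U, T0 B P hs f U ∂_ = 0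
  simp only [T0_apply]
  exact integral_linkLap_eq_zero B (hs _ hfP)

omit [NeZero L] in
/-- `range ρ₀ =` the part of `V` vanishing at `1`. [folklore] -/
theorem range_rho0_eq :
    LinearMap.range (rho0 P) = (LinearMap.ker (evalV P)).map (LinearMap.range (rhoP P)).subtype := by
  apply le_antisymm
  · rintro w ⟨f, rfl⟩
    have hf := (mem_P0 P _).1 f.2
    refine ⟨⟨rho0 P f, ⟨⟨(f : AmbConfig d L n → ℝ), hf.1⟩, rfl⟩⟩, ?_, rfl⟩
    show evalV P ⟨rho0 P f, _⟩ = 0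
    rw [evalV_apply]
    exact hf.2
  · rintro w ⟨v, hv, rfl⟩
    obtain ⟨g, hg⟩ := v.2
    have hv' : (v : GaugeConfig d L (Matrix.specialUnitaryGroup (Fin n) ℂ) → ℝ) (fun _ => 1) = 0 := hv
    have hg0 : (g : AmbConfig d L n → ℝ) ∈ P0 P := by
      rw [mem_P0]
      refine ⟨g.2, ?_⟩
      rw [← hg] at hv'
      exact hv'
    exact ⟨⟨(g : AmbConfig d L n → ℝ), hg0⟩, hg⟩

/-- The two kernels have the same dimension `dim V - 1`. [folklore] -/
theorem finrank_ker_meanV_eq (hs : ∀ f ∈ P, ContDiff ℝ ∞ f) (h1 : (fun _ => (1 : ℝ)) ∈ P)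
    [FiniteDimensional ℝ P] :
    Module.finrank ℝ (LinearMap.ker (meanV hs)) = Module.finrank ℝ (LinearMap.ker (evalV P)) := by
  have ha := finrank_ker_add_one_of_apply_ne_zero (meanV hs) (v := oneV h1)
    (by rw [meanV_oneV]; exact one_ne_zero)
  have hb := finrank_ker_add_one_of_apply_ne_zero (evalV P) (v := oneV h1)
    (by rw [evalV_oneV]; exact one_ne_zero)
  omega

/-- **`range T₀` is exactly the mean-zero part of `V`.** [cite: Luscher2010Trivializing, §4.2–§4.3] -/
theorem range_T0_eq (hs : ∀ f ∈ P, ContDiff ℝ ∞ f) (hΔ : ∀ f ∈ P, linkLap B f ∈ P)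
    (h1 : (fun _ => (1 : ℝ)) ∈ P) [FiniteDimensional ℝ P] :
    LinearMap.range (T0 B P hs) =
      (LinearMap.ker (meanV hs)).map (LinearMap.range (rhoP P)).subtype := by
  refine Submodule.eq_of_le_of_finrank_eq (range_T0_le hs hΔ) ?_
  rw [Submodule.finrank_map_subtype_eq, finrank_range_T0_eq hs, range_rho0_eq,
    Submodule.finrank_map_subtype_eq, finrank_ker_meanV_eq hs h1]

/-- **Solvability of `Δf = g - ⟨g⟩` inside a finite-dimensional `Δ`-stable space of smooth functionals
containing the constants** (Lüscher's inversion of `Δ` on the complement of the constants, §4.3, in the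
polynomial setting of §4.4): for `g ∈ P` there is `f ∈ P`, vanishing at `ι 1`, with `Δf = g - ∫ D[U] g` on
`SU(n)^E`. [cite: Luscher2010Trivializing, §4.3 eqs. (4.12)–(4.15), §4.4] -/
theorem exists_linkLap_eq_sub_mean (hs : ∀ f ∈ P, ContDiff ℝ ∞ f) (hΔ : ∀ f ∈ P, linkLap B f ∈ P)
    (h1 : (fun _ => (1 : ℝ)) ∈ P) [FiniteDimensional ℝ P] {g : AmbConfig d L n → ℝ} (hg : g ∈ P) :
    ∃ f ∈ P, f (WilsonFlow.coeConfig fun _ => 1) = 0 ∧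
      ∀ U : GaugeConfig d L (Matrix.specialUnitaryGroup (Fin n) ℂ),
        linkLap B f (WilsonFlow.coeConfig U) = g (WilsonFlow.coeConfig U) -
          ∫ U', g (WilsonFlow.coeConfig U') ∂(trivialMeasure (Matrix.specialUnitaryGroup (Fin n) ℂ) d L) := by
  set m : ℝ := ∫ U', g (WilsonFlow.coeConfig U')
    ∂(trivialMeasure (Matrix.specialUnitaryGroup (Fin n) ℂ) d L) with hm
  -- the mean-zero element `g|_{SU^E} - m·1` of `V`
  set v : LinearMap.range (rhoP P) :=
    ⟨rhoP P ⟨g, hg⟩, LinearMap.mem_range_self _ _⟩ - m • oneV h1 with hv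
  have hvA : v ∈ LinearMap.ker (meanV hs) := by
    rw [LinearMap.mem_ker, hv, map_sub, map_smul, meanV_oneV, smul_eq_mul, mul_one, sub_eq_zero,
      meanV_apply]
    rfl
  have hvR : (LinearMap.range (rhoP P)).subtype v ∈ LinearMap.range (T0 B P hs) := by
    rw [range_T0_eq hs hΔ h1]; exact ⟨v, hvA, rfl⟩
  obtain ⟨f, hf⟩ := hvR
  have hfP := (mem_P0 P _).1 f.2
  refine ⟨(f : AmbConfig d L n → ℝ), hfP.1, hfP.2, fun U => ?_⟩
  have hU := congrFun hf U
  rw [T0_apply] at hU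
  rw [hU, hv]
  simp [rhoP_apply, coe_oneV, hm]

/-- Constant form: there are `f ∈ P` and `c ∈ ℝ` (namely `c = -∫ D[U] g`) with `Δf = g + c` on `SU(n)^E`.
[cite: Luscher2010Trivializing, §4.3 eqs. (4.14)–(4.15)] -/
theorem exists_linkLap_eq_add_const (hs : ∀ f ∈ P, ContDiff ℝ ∞ f) (hΔ : ∀ f ∈ P, linkLap B f ∈ P)
    (h1 : (fun _ => (1 : ℝ)) ∈ P) [FiniteDimensional ℝ P] {g : AmbConfig d L n → ℝ} (hg : g ∈ P) :
    ∃ f ∈ P, ∃ c : ℝ, ∀ U : GaugeConfig d L (Matrix.specialUnitaryGroup (Fin n) ℂ),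
      linkLap B f (WilsonFlow.coeConfig U) = g (WilsonFlow.coeConfig U) + c := by
  obtain ⟨f, hfP, -, hf⟩ := exists_linkLap_eq_sub_mean hs hΔ h1 hg
  exact ⟨f, hfP, -∫ U', g (WilsonFlow.coeConfig U')
    ∂(trivialMeasure (Matrix.specialUnitaryGroup (Fin n) ℂ) d L), fun U => by rw [hf U]; ring⟩

end Solver

end

end Summit.Ventures.LatticeQCDFlow.TrivializingMaps
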